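import Mathlib
import Summits.ValiantsHypothesis.ValiantsHypothesis.Theorems.FifoMatchingNNLinearDegreeCofactorHardQueueLineage
import HarnessLib

/-!
# Crux `NNLinearDegreeCofactorHard` (stmt-ValiantsHypothesis-23918), line `internal_cofactor`: GENERATIONS of the abstract
# queue history (unit U1 of the (D*) architecture, `Lines/internal_cofactor-S2b-shed-design-p1.md`)

On the abstract queue history of `…NNMonotoneHardBoundaries` (letters `W`, ranks `rO rC`, item times `o c`; item `k` is
pushed at `o k`, popped at `c k`; at time `t` the queue is the item interval `[rC t, rO t)`), the GENERATION SUCCESSOR of a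
time `t` with a non-empty queue is `gen c rO t := c (rO t − 1) + 1`, the time right after the last item alive at `t` is
popped.  Then:

* `rankC_closer`, `closer_lt_closer_iff` — item `k` is popped at a pop time, `rC (c k) = k`, and `c` is increasing;
* `lt_gen`, `rankC_gen` — `t < gen t` and `rC (gen t) = rO t`: at `gen t` everything alive at `t` has been popped and
  the front is the first item pushed at or after `t`; so the items alive at `gen t` are exactly those pushed in `[t, gen t)`
  and the FRONTS during `[t, gen t)` are exactly the items alive at `t` (`rankC_mem_of_lt_gen`);
* `genTime A j` — the generation times `T₀ = A`, `T_{j+1} = gen T_j`; `genTime_strictMono`-type facts;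
* `sum_card_boundaries_le` — **arrivals split over generations**: the colour boundaries (`σ (o k) ≠ σ (o (k−1))`) strictly
  inside the alive intervals of `T₀, …, T_m` are pairwise distinct, hence their total is at most the number of boundaries in
  `(rC A, rO T_m)`;
* `exists_boundary_of_two_colours` — if two items alive at `t` have different colours, a boundary lies strictly inside the
  alive interval;
* `card_filter_le_mul_card_gens` — **pigeonhole over generations**: if at most `Z` items with property `P` are alive at each
  `T_j` (`j ≤ m`), the items with `P` in `[rC A, rO T_m)` number at most `Z · #{j ≤ m : some alive item at T_j has P}`.

Deterministic bookkeeping for (D*) (μ* = shedWord) — and usable by (D‴); nothing here proves S2b, the crux or VP ≠ VNP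
(not proved). [folklore]
-/

-- Sub = Summit single-conjunct layout: the duplicated namespace component is mandated by the tree.
set_option linter.dupNamespace false

namespace Summit.ValiantsHypothesis.ValiantsHypothesis.Theorems.FifoMatching.NNLinearDegreeCofactorHard.QueueHistory

open Finset
open Summit.ValiantsHypothesis.ValiantsHypothesis.Theorems.FifoMatching.NNMonotoneHard

/-- The GENERATION SUCCESSOR of time `t`: one past the pop time of the last item alive at `t` (item `rO t − 1`). [folklore] -/
def gen (c rO : ℕ → ℕ) (t : ℕ) : ℕ := c (rO t - 1) + 1

/-- The generation times from `A`: `T₀ = A`, `T_{j+1} = gen T_j`. [folklore] -/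
def genTime (c rO : ℕ → ℕ) (A : ℕ) : ℕ → ℕ
  | 0 => A
  | j + 1 => gen c rO (genTime c rO A j)

section AbstractQueue

variable {W σ : ℕ → Bool} {rO rC o c : ℕ → ℕ} {n' : ℕ}
variable (hOs : ∀ t, rO (t + 1) = rO t + (if W t = true then 1 else 0))
  (hCs : ∀ t, rC (t + 1) = rC t + (if W t = true then 0 else 1))
  (ho : ∀ k t, k < n' → (o k < t ↔ k < rO t))
  (hc : ∀ k t, k < n' → (c k < t ↔ k < rC t))

/-! ### Items and their pop times -/

include hCs hc in
/-- **Item `k` is the `k`-th pop**: `rC (c k) = k`, and the letter at `c k` is a pop. [folklore] -/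
theorem rankC_closer {k : ℕ} (hk : k < n') : rC (c k) = k ∧ W (c k) = false := by
  have h1 : ¬ k < rC (c k) := fun h => lt_irrefl _ ((hc k (c k) hk).2 h)
  have h2 : k < rC (c k + 1) := (hc k (c k + 1) hk).1 (Nat.lt_succ_self _)
  rw [hCs] at h2
  cases hW : W (c k)
  · rw [hW] at h2; simp at h2; exact ⟨by omega, rfl⟩
  · rw [hW] at h2; simp at h2; omega

include hCs hc in
/-- Items are popped in order: `c i < c j ↔ i < j`. [folklore] -/
theorem closer_lt_closer_iff {i j : ℕ} (hi : i < n') (hj : j < n') : c i < c j ↔ i < j := by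
  rw [hc i (c j) hi, (rankC_closer hCs hc hj).1]

include hCs hc in
/-- Right after item `k` is popped the pop rank is `k + 1`. [folklore] -/
theorem rankC_closer_succ {k : ℕ} (hk : k < n') : rC (c k + 1) = k + 1 := by
  obtain ⟨h1, h2⟩ := rankC_closer hCs hc hk
  rw [hCs, h1, h2]; simp

/-! ### The generation successor -/

include hc in
/-- **`t < gen t`** when the queue at `t` is non-empty (its last item `rO t − 1 < n'`). [folklore] -/
theorem lt_gen {t : ℕ} (hne : rC t < rO t) (hn : rO t ≤ n') : t < gen c rO t := by
  unfold gen
  have hk : rO t - 1 < n' := by omega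
  have h : ¬ (c (rO t - 1) < t) := fun h => by
    have := (hc _ _ hk).1 h; omega
  omega

include hCs hc in
/-- **At `gen t` the front is the first item pushed at or after `t`**: `rC (gen t) = rO t`. [folklore] -/
theorem rankC_gen {t : ℕ} (hne : rC t < rO t) (hn : rO t ≤ n') : rC (gen c rO t) = rO t := by
  unfold gen
  have hk : rO t - 1 < n' := by omega
  rw [rankC_closer_succ hCs hc hk]
  omega

include hCs hc in
/-- **The fronts during `[t, gen t)` are the items alive at `t`**: for `t ≤ s < gen t`, `rC t ≤ rC s < rO t`. [folklore] -/
theorem rankC_mem_of_lt_gen {t s : ℕ} (hne : rC t < rO t) (hn : rO t ≤ n') (hts : t ≤ s) (hs : s < gen c rO t) :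
    rC t ≤ rC s ∧ rC s < rO t := by
  refine ⟨rankC_mono hCs hts, ?_⟩
  unfold gen at hs
  have hk : rO t - 1 < n' := by omega
  have h : ¬ (rO t - 1 < rC s) := fun h => by
    have := (hc _ _ hk).2 h; omega
  omega

include hOs hCs hc in
/-- During `[t, gen t)` the queue keeps every item pushed since `t`: `rC s < rO t ≤ rO s`, in particular it is
non-empty. [folklore] -/
theorem rankC_lt_rankO_of_lt_gen {t s : ℕ} (hne : rC t < rO t) (hn : rO t ≤ n') (hts : t ≤ s) (hs : s < gen c rO t) :
    rC s < rO s :=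
  lt_of_lt_of_le (rankC_mem_of_lt_gen hCs hc hne hn hts hs).2 (rankO_mono hOs hts)

/-! ### Generation times -/

/-- `genTime` unfolds. [folklore] -/
@[simp] theorem genTime_zero (A : ℕ) : genTime c rO A 0 = A := rfl

/-- `genTime` unfolds. [folklore] -/
theorem genTime_succ (A j : ℕ) : genTime c rO A (j + 1) = gen c rO (genTime c rO A j) := rfl

include hCs hc in
/-- Along the generations (queues non-empty, items existing): the pop rank at `T_{j+1}` is the push rank at `T_j`, so the
items alive at `T_{j+1}` are exactly those pushed during generation `j`. [folklore] -/
theorem rankC_genTime_succ {A m : ℕ} (hne : ∀ j ≤ m, rC (genTime c rO A j) < rO (genTime c rO A j))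
    (hn : ∀ j ≤ m, rO (genTime c rO A j) ≤ n') {j : ℕ} (hj : j ≤ m) :
    rC (genTime c rO A (j + 1)) = rO (genTime c rO A j) := by
  rw [genTime_succ]; exact rankC_gen hCs hc (hne j hj) (hn j hj)

include hc in
/-- Generation times increase. [folklore] -/
theorem genTime_lt_succ {A m : ℕ} (hne : ∀ j ≤ m, rC (genTime c rO A j) < rO (genTime c rO A j))
    (hn : ∀ j ≤ m, rO (genTime c rO A j) ≤ n') {j : ℕ} (hj : j ≤ m) :
    genTime c rO A j < genTime c rO A (j + 1) := by
  rw [genTime_succ]; exact lt_gen hc (hne j hj) (hn j hj)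

include hOs hc in
/-- Push ranks increase along the generations. [folklore] -/
theorem rankO_genTime_mono {A m : ℕ} (hne : ∀ j ≤ m, rC (genTime c rO A j) < rO (genTime c rO A j))
    (hn : ∀ j ≤ m, rO (genTime c rO A j) ≤ n') {i j : ℕ} (hij : i ≤ j) (hj : j ≤ m + 1) :
    rO (genTime c rO A i) ≤ rO (genTime c rO A j) := by
  induction j, hij using Nat.le_induction with
  | base => exact le_rfl
  | succ j hij ih =>
    exact (ih (Nat.le_of_succ_le hj)).trans
      (rankO_mono hOs (le_of_lt (genTime_lt_succ hc hne hn (Nat.le_of_lt_succ hj))))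

/-! ### Arrivals split over generations -/

include hc in
/-- Generation times are at least the starting time. [folklore] -/
theorem le_genTime {A m : ℕ} (hne : ∀ j ≤ m, rC (genTime c rO A j) < rO (genTime c rO A j))
    (hn : ∀ j ≤ m, rO (genTime c rO A j) ≤ n') {j : ℕ} (hj : j ≤ m + 1) : A ≤ genTime c rO A j := by
  induction j with
  | zero => exact le_rfl
  | succ j ih =>
    exact (ih (Nat.le_of_succ_le hj)).trans (le_of_lt (genTime_lt_succ hc hne hn (Nat.le_of_lt_succ hj)))

include hOs hCs hc in
/-- The alive interval of generation `j ≥ 1` starts where the previous push rank ended; all alive intervals lie in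
`[rC A, rO T_m)`. [folklore] -/
theorem Ico_alive_subset {A m : ℕ} (hne : ∀ j ≤ m, rC (genTime c rO A j) < rO (genTime c rO A j))
    (hn : ∀ j ≤ m, rO (genTime c rO A j) ≤ n') {j : ℕ} (hj : j ≤ m) :
    rC A ≤ rC (genTime c rO A j) ∧ rO (genTime c rO A j) ≤ rO (genTime c rO A m) :=
  ⟨rankC_mono hCs (le_genTime hc hne hn (hj.trans (Nat.le_succ m))),
    rankO_genTime_mono hOs hc hne hn hj (Nat.le_succ_of_le le_rfl)⟩

include hOs hCs hc in
/-- Alive index intervals of different generations are disjoint (as intervals: one ends before the other starts).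
[folklore] -/
theorem rankO_le_rankC_of_lt {A m : ℕ} (hne : ∀ j ≤ m, rC (genTime c rO A j) < rO (genTime c rO A j))
    (hn : ∀ j ≤ m, rO (genTime c rO A j) ≤ n') {i j : ℕ} (hij : i < j) (hj : j ≤ m) :
    rO (genTime c rO A i) ≤ rC (genTime c rO A j) := by
  obtain ⟨j', rfl⟩ : ∃ j', j = j' + 1 := ⟨j - 1, by omega⟩
  rw [rankC_genTime_succ hCs hc hne hn (Nat.le_of_succ_le hj)]
  exact rankO_genTime_mono hOs hc hne hn (Nat.le_of_lt_succ hij) (by omega)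

include hOs hCs hc in
/-- **The boundaries strictly inside the alive intervals of `T₀,…,T_m` are distinct and all lie in `(rC A, rO T_m)`.**
[folklore] -/
theorem sum_card_boundaries_le (bd : ℕ → Prop) [DecidablePred bd] {A m : ℕ}
    (hne : ∀ j ≤ m, rC (genTime c rO A j) < rO (genTime c rO A j)) (hn : ∀ j ≤ m, rO (genTime c rO A j) ≤ n') :
    ∑ j ∈ range (m + 1), ((Ioo (rC (genTime c rO A j)) (rO (genTime c rO A j))).filter bd).card ≤
      ((Ioo (rC A) (rO (genTime c rO A m))).filter bd).card := by
  classical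
  rw [← card_biUnion]
  · refine card_le_card fun k hk => ?_
    rw [mem_biUnion] at hk
    obtain ⟨j, hj, hk⟩ := hk
    have hj' : j ≤ m := Nat.le_of_lt_succ (mem_range.1 hj)
    obtain ⟨h1, h2⟩ := Ico_alive_subset hOs hCs hc hne hn hj'
    rw [mem_filter, mem_Ioo] at hk ⊢
    exact ⟨⟨lt_of_le_of_lt h1 hk.1.1, lt_of_lt_of_le hk.1.2 h2⟩, hk.2⟩
  · intro i hi j hj hij
    have hi' : i ≤ m := Nat.le_of_lt_succ (mem_coe.1 hi |> mem_range.1)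
    have hj' : j ≤ m := Nat.le_of_lt_succ (mem_coe.1 hj |> mem_range.1)
    rw [Function.onFun, disjoint_left]
    intro k hk1 hk2
    have hk1' := (mem_Ioo.1 (mem_filter.1 hk1).1)
    have hk2' := (mem_Ioo.1 (mem_filter.1 hk2).1)
    rcases Nat.lt_or_gt_of_ne hij with h | h
    · have := rankO_le_rankC_of_lt hOs hCs hc hne hn h hj'; omega
    · have := rankO_le_rankC_of_lt hOs hCs hc hne hn h hi'; omega

/-- **Two colours among the alive items give a boundary strictly inside the alive interval.** [folklore] -/
theorem exists_boundary_of_two_colours (f : ℕ → Bool) {lo hi k₁ k₂ : ℕ} (h₁ : lo ≤ k₁) (h₁' : k₁ < hi)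
    (h₂ : lo ≤ k₂) (h₂' : k₂ < hi) (hne : f k₁ ≠ f k₂) :
    ∃ k, lo < k ∧ k < hi ∧ f k ≠ f (k - 1) := by
  rcases lt_trichotomy k₁ k₂ with h | h | h
  · obtain ⟨k, hk1, hk2, hk3⟩ := exists_boundary_between f h hne
    exact ⟨k, by omega, by omega, hk3⟩
  · exact absurd (h ▸ rfl) hne
  · obtain ⟨k, hk1, hk2, hk3⟩ := exists_boundary_between f h (Ne.symm hne)
    exact ⟨k, by omega, by omega, hk3⟩

/-! ### Pigeonhole over generations -/

include hCs hc in
/-- Every item of `[rC A, rO T_m)` is alive at some generation time `T_j`, `j ≤ m`. [folklore] -/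
theorem exists_gen_alive {A m : ℕ} (hne : ∀ j ≤ m, rC (genTime c rO A j) < rO (genTime c rO A j))
    (hn : ∀ j ≤ m, rO (genTime c rO A j) ≤ n') {k : ℕ} (hk1 : rC A ≤ k) (hk2 : k < rO (genTime c rO A m)) :
    ∃ j, j ≤ m ∧ rC (genTime c rO A j) ≤ k ∧ k < rO (genTime c rO A j) := by
  classical
  have hex : ∃ j, k < rO (genTime c rO A j) := ⟨m, hk2⟩
  set j₀ := Nat.find hex with hj₀
  have hj₀k : k < rO (genTime c rO A j₀) := Nat.find_spec hex
  have hj₀m : j₀ ≤ m := Nat.find_min' hex hk2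
  refine ⟨j₀, hj₀m, ?_, hj₀k⟩
  rcases Nat.eq_zero_or_pos j₀ with h0 | hpos
  · rw [h0]; simpa using hk1
  · obtain ⟨j', hj'⟩ : ∃ j', j₀ = j' + 1 := ⟨j₀ - 1, by omega⟩
    have hmin : ¬ k < rO (genTime c rO A j') := Nat.find_min hex (by omega)
    rw [hj', rankC_genTime_succ hCs hc hne hn (by omega)]
    omega

include hCs hc in
/-- **Pigeonhole over generations.**  If at most `Z` items with property `P` are alive at each generation time `T_j`
(`j ≤ m`), then the items with `P` among `[rC A, rO T_m)` number at most `Z` times the number of generations at which some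
item with `P` is alive. [folklore] -/
theorem card_filter_le_mul_card_gens (P : ℕ → Prop) [DecidablePred P] {A m Z : ℕ}
    (hne : ∀ j ≤ m, rC (genTime c rO A j) < rO (genTime c rO A j)) (hn : ∀ j ≤ m, rO (genTime c rO A j) ≤ n')
    (hZ : ∀ j ≤ m, ((Ico (rC (genTime c rO A j)) (rO (genTime c rO A j))).filter P).card ≤ Z) :
    ((Ico (rC A) (rO (genTime c rO A m))).filter P).card ≤
      Z * ((range (m + 1)).filter fun j => ∃ k ∈ Ico (rC (genTime c rO A j)) (rO (genTime c rO A j)), P k).card := by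
  classical
  set G := (range (m + 1)).filter fun j => ∃ k ∈ Ico (rC (genTime c rO A j)) (rO (genTime c rO A j)), P k with hG
  have hcover : (Ico (rC A) (rO (genTime c rO A m))).filter P ⊆
      G.biUnion fun j => (Ico (rC (genTime c rO A j)) (rO (genTime c rO A j))).filter P := by
    intro k hk
    rw [mem_filter, mem_Ico] at hk
    obtain ⟨⟨hk1, hk2⟩, hP⟩ := hk
    obtain ⟨j, hjm, hj1, hj2⟩ := exists_gen_alive hCs hc hne hn hk1 hk2
    rw [mem_biUnion]
    refine ⟨j, ?_, mem_filter.2 ⟨mem_Ico.2 ⟨hj1, hj2⟩, hP⟩⟩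
    rw [hG, mem_filter]
    exact ⟨mem_range.2 (Nat.lt_succ_of_le hjm), k, mem_Ico.2 ⟨hj1, hj2⟩, hP⟩
  calc ((Ico (rC A) (rO (genTime c rO A m))).filter P).card
      ≤ (G.biUnion fun j => (Ico (rC (genTime c rO A j)) (rO (genTime c rO A j))).filter P).card := card_le_card hcover
    _ ≤ ∑ j ∈ G, ((Ico (rC (genTime c rO A j)) (rO (genTime c rO A j))).filter P).card := card_biUnion_le
    _ ≤ ∑ _j ∈ G, Z := sum_le_sum fun j hj => hZ j (Nat.le_of_lt_succ (mem_range.1 (mem_filter.1 hj).1))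
    _ = Z * G.card := by rw [sum_const, smul_eq_mul, mul_comm]

end AbstractQueue

end Summit.ValiantsHypothesis.ValiantsHypothesis.Theorems.FifoMatching.NNLinearDegreeCofactorHard.QueueHistory
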